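import Mathlib
import Literature.Analysis.FluidPDE.LoopCirculation
import HarnessLib

/-!
# Route `TautLoopKelvin`, crux `TautLoopLaw` (stmt-NavierStokesRegularity-15249), line
  `Sketch-ideas-r1k1` (Dini–Saks architecture) — tools stub `stub_tautLoopStepWeberTools`

Weber–Kelvin pull-back of circulations by a `C¹` map and the second-order consistency of the
pulled-back transport, serving the two open skeleton stubs (random-walk selection and the
exact-level step) of the line:

1. **Weber / Cauchy–Kelvin pull-back identity.** For a `C¹` map `A : ℝ³ → ℝ³`, a field `f` and a
   closed `C¹` loop `γ`, `∮_{A ∘ γ} f · dℓ = ∮_γ (DA)† (f ∘ A) · dℓ`: the chain rule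
   `(A ∘ γ)′ = DA(γ) γ′` and `⟪f, DA γ′⟫ = ⟪(DA)† f, γ′⟫` pointwise in the parameter
   (`†` the adjoint for the Euclidean inner product).
2. **Images of loops.** `A ∘ γ` is again a closed `C¹` loop.
3. **Consistency to second order.** If `A = id − τ w + O(τ²)` and `DA = id − τ Dw + O(τ²)`
   uniformly, `0 ≤ τ ≤ 1`, with `f` bounded in `C²` and `w` bounded in `C¹`, then
   `(DA)† (f ∘ A) = f − τ [(Df) w + (Dw)† f] + O(τ²)` in sup norm, with a constant depending only
   on the stated bounds: first-order Taylor expansion of `f` at `x` by the mean value inequality,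
   `‖T†‖ = ‖T‖`, and bookkeeping of the cross terms.

All statements are folklore (Majda–Bertozzi, *Vorticity and Incompressible Flow*, §1.6, proof of
Prop. 1.11; the Weber-formula form of ideal hydrodynamics); everything is proved from Mathlib and
the loop API of `Literature.Analysis.FluidPDE.LoopCirculation`.
-/

noncomputable section

open Set Function Real intervalIntegral Literature.Analysis.FluidPDE
open ContinuousLinearMap (adjoint)
open scoped InnerProductSpace RealInnerProductSpace

namespace Summit.NavierStokesRegularity.NavierStokesRegularity.Theorems

set_option linter.dupNamespace false

/-! ## The pull-back identity and images of loops -/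

section PullBack

variable {E : Type*} [NormedAddCommGroup E] [InnerProductSpace ℝ E] [CompleteSpace E]

/-- **Weber / Cauchy–Kelvin pull-back identity.** For differentiable `A` and `γ` and any field
`f`, the circulation of `f` around `A ∘ γ` is the circulation around `γ` of the pulled-back
covector field `x ↦ (DA(x))† f(A x)` (chain rule and the defining property of the adjoint,
pointwise in the parameter). [folklore] -/
theorem tautLoopWeber_circulation_comp {A : E → E} (f : E → E) {γ : ℝ → E}
    (hA : Differentiable ℝ A) (hγ : Differentiable ℝ γ) :
    circulation f (A ∘ γ) = circulation (fun x => adjoint (fderiv ℝ A x) (f (A x))) γ := by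
  unfold circulation
  refine integral_congr fun s _ => ?_
  show ⟪f ((A ∘ γ) s), deriv (A ∘ γ) s⟫ = ⟪adjoint (fderiv ℝ A (γ s)) (f (A (γ s))), deriv γ s⟫
  rw [fderiv_comp_deriv s (hA (γ s)) (hγ s), ContinuousLinearMap.adjoint_inner_left]
  rfl

/-- The pull-back identity for a `C¹` map and a closed `C¹` loop. [folklore] -/
theorem tautLoopWeber_circulation_comp_of_isC1Loop {A : E → E} (f : E → E) {γ : ℝ → E}
    (hA : ContDiff ℝ 1 A) (hγ : IsC1Loop γ) :
    circulation f (A ∘ γ) = circulation (fun x => adjoint (fderiv ℝ A x) (f (A x))) γ :=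
  tautLoopWeber_circulation_comp f (hA.differentiable one_ne_zero) hγ.differentiable

omit [InnerProductSpace ℝ E] [CompleteSpace E] in
/-- The image of a closed `C¹` loop under a `C¹` map is a closed `C¹` loop. [folklore] -/
theorem tautLoopWeber_isC1Loop_comp [NormedSpace ℝ E] {A : E → E} {γ : ℝ → E}
    (hA : ContDiff ℝ 1 A) (hγ : IsC1Loop γ) : IsC1Loop (A ∘ γ) :=
  ⟨hA.comp hγ.contDiff, hγ.periodic.comp A⟩

end PullBack

/-! ## First-order Taylor expansion by the mean value inequality -/

section Taylor

variable {E F : Type*} [NormedAddCommGroup E] [NormedSpace ℝ E] [NormedAddCommGroup F]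
  [NormedSpace ℝ F]

/-- A bound on the second derivative of a `C²` map makes its derivative Lipschitz:
`‖Df(y) − Df(x)‖ ≤ F₂ ‖y − x‖` (mean value inequality for `Df`,
`‖D(Df)‖ = ‖D²f‖`). [folklore] -/
theorem tautLoopWeber_norm_fderiv_sub_le {f : E → F} {F₂ : ℝ} (hf : ContDiff ℝ 2 f)
    (hF₂ : ∀ x, ‖iteratedFDeriv ℝ 2 f x‖ ≤ F₂) (x y : E) :
    ‖fderiv ℝ f y - fderiv ℝ f x‖ ≤ F₂ * ‖y - x‖ := by
  have hd : Differentiable ℝ (fderiv ℝ f) :=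
    (hf.fderiv_right (m := 1) (by norm_num)).differentiable one_ne_zero
  refine convex_univ.norm_image_sub_le_of_norm_fderiv_le (fun z _ => hd z) (fun z _ => ?_)
    (mem_univ x) (mem_univ y)
  rw [← norm_iteratedFDeriv_one (𝕜 := ℝ), norm_iteratedFDeriv_fderiv]
  exact hF₂ z

/-- **First-order Taylor expansion with quadratic remainder**: for a `C²` map with
`‖D²f‖ ≤ F₂`, `‖f(y) − f(x) − Df(x)(y − x)‖ ≤ F₂ ‖y − x‖²` (mean value inequality on the closed
ball of radius `‖y − x‖` about `x` applied to `f − Df(x)`, whose derivative `Df − Df(x)` is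
bounded there by `F₂ ‖y − x‖`). [folklore] -/
theorem tautLoopWeber_taylor_remainder {f : E → F} {F₂ : ℝ} (hf : ContDiff ℝ 2 f)
    (hF₂ : ∀ x, ‖iteratedFDeriv ℝ 2 f x‖ ≤ F₂) (x y : E) :
    ‖f y - f x - fderiv ℝ f x (y - x)‖ ≤ F₂ * ‖y - x‖ ^ 2 := by
  have hd : Differentiable ℝ f := hf.differentiable (by norm_num)
  have hF₂0 : 0 ≤ F₂ := (norm_nonneg _).trans (hF₂ x)
  have hball : ∀ z ∈ Metric.closedBall x ‖y - x‖,
      ‖fderiv ℝ f z - fderiv ℝ f x‖ ≤ F₂ * ‖y - x‖ := by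
    intro z hz
    rw [Metric.mem_closedBall, dist_eq_norm] at hz
    calc ‖fderiv ℝ f z - fderiv ℝ f x‖ ≤ F₂ * ‖z - x‖ :=
          tautLoopWeber_norm_fderiv_sub_le hf hF₂ x z
      _ ≤ F₂ * ‖y - x‖ := by gcongr
  have h := (convex_closedBall x ‖y - x‖).norm_image_sub_le_of_norm_fderiv_le'
    (fun z _ => hd z) hball (Metric.mem_closedBall_self (norm_nonneg _))
    (by rw [Metric.mem_closedBall, dist_eq_norm])
  calc ‖f y - f x - fderiv ℝ f x (y - x)‖ ≤ F₂ * ‖y - x‖ * ‖y - x‖ := h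
    _ = F₂ * ‖y - x‖ ^ 2 := by ring

/-- **The transported field to second order.** If `‖y − (x − τ wₓ)‖ ≤ K₁ τ²` (`0 ≤ τ ≤ 1`,
`‖wₓ‖ ≤ W₀`) and `f` is `C²` with `‖Df‖ ≤ F₁`, `‖D²f‖ ≤ F₂`, then
`‖f(y) − (f(x) − τ Df(x) wₓ)‖ ≤ (F₂ (K₁ + W₀)² + F₁ K₁) τ²`. [folklore] -/
theorem tautLoopWeber_transport_remainder {f : E → F} {F₁ F₂ K₁ W₀ τ : ℝ} {x y wx : E}
    (hτ₀ : 0 ≤ τ) (hτ₁ : τ ≤ 1) (hK₁ : 0 ≤ K₁) (hf : ContDiff ℝ 2 f)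
    (hF₁ : ∀ x, ‖fderiv ℝ f x‖ ≤ F₁) (hF₂ : ∀ x, ‖iteratedFDeriv ℝ 2 f x‖ ≤ F₂)
    (hy : ‖y - (x - τ • wx)‖ ≤ K₁ * τ ^ 2) (hwx : ‖wx‖ ≤ W₀) :
    ‖f y - (f x - τ • fderiv ℝ f x wx)‖ ≤ (F₂ * (K₁ + W₀) ^ 2 + F₁ * K₁) * τ ^ 2 := by
  have hF₂0 : 0 ≤ F₂ := (norm_nonneg _).trans (hF₂ x)
  have hW₀ : 0 ≤ W₀ := (norm_nonneg _).trans hwx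
  -- `y - x = (y - (x - τ wₓ)) - τ wₓ` has norm `≤ K₁ τ² + τ W₀ ≤ τ (K₁ + W₀)`
  have hyx : ‖y - x‖ ≤ τ * (K₁ + W₀) := by
    have h1 : y - x = (y - (x - τ • wx)) - τ • wx := by abel
    have hτ2 : τ ^ 2 ≤ τ := by nlinarith
    calc ‖y - x‖ ≤ K₁ * τ ^ 2 + ‖τ • wx‖ := by rw [h1]; exact norm_sub_le_of_le hy le_rfl
      _ ≤ K₁ * τ + τ * W₀ := by
          rw [norm_smul, Real.norm_eq_abs, abs_of_nonneg hτ₀]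
          gcongr
      _ = τ * (K₁ + W₀) := by ring
  have hsplit : f y - (f x - τ • fderiv ℝ f x wx) =
      (f y - f x - fderiv ℝ f x (y - x)) + fderiv ℝ f x (y - (x - τ • wx)) := by
    simp only [map_sub, map_smul]
    abel
  rw [hsplit]
  have h1 : ‖f y - f x - fderiv ℝ f x (y - x)‖ ≤ F₂ * (τ * (K₁ + W₀)) ^ 2 :=
    (tautLoopWeber_taylor_remainder hf hF₂ x y).trans (by gcongr)
  have h2 : ‖fderiv ℝ f x (y - (x - τ • wx))‖ ≤ F₁ * (K₁ * τ ^ 2) :=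
    ((fderiv ℝ f x).le_opNorm _).trans
      (mul_le_mul (hF₁ x) hy (norm_nonneg _) ((norm_nonneg _).trans (hF₁ x)))
  calc _ ≤ F₂ * (τ * (K₁ + W₀)) ^ 2 + F₁ * (K₁ * τ ^ 2) := norm_add_le_of_le h1 h2
    _ = (F₂ * (K₁ + W₀) ^ 2 + F₁ * K₁) * τ ^ 2 := by ring

end Taylor

/-! ## Bookkeeping of the adjoint transport -/

section Adjoint

variable {E : Type*} [NormedAddCommGroup E] [InnerProductSpace ℝ E] [CompleteSpace E]

/-- `T† v − (v − τ S† v) = (T − (id − τ S))† v` (the adjoint is additive, real-homogeneous and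
fixes the identity). [folklore] -/
theorem tautLoopWeber_adjoint_expand (T S : E →L[ℝ] E) (τ : ℝ) (v : E) :
    adjoint T v - (v - τ • adjoint S v) =
      adjoint (T - (ContinuousLinearMap.id ℝ E - τ • S)) v := by
  simp [map_sub]

/-- **Pointwise second-order bookkeeping.** With `D := T − (id − τ S)` and
`r := f_A − (fₓ − τ L wₓ)`, one has the exact identity
`T† f_A − (fₓ − τ (L wₓ + S† fₓ)) = D† f_A + r − τ S† r + τ² S† (L wₓ)`; if `‖D‖ ≤ K₂ τ²`,
`‖r‖ ≤ C₁ τ²`, `‖f_A‖ ≤ F₀`, `‖L‖ ≤ F₁`, `‖S‖ ≤ W₁`, `‖wₓ‖ ≤ W₀` and `0 ≤ τ ≤ 1`, the left side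
has norm `≤ (K₂ F₀ + C₁ + W₁ C₁ + W₁ F₁ W₀) τ²` (`‖D†‖ = ‖D‖`, `‖S†‖ = ‖S‖`). [folklore] -/
theorem tautLoopWeber_pointwise {T S L : E →L[ℝ] E} {fx fAx wx : E}
    {τ K₂ C₁ F₀ F₁ W₀ W₁ : ℝ} (hτ₀ : 0 ≤ τ) (hτ₁ : τ ≤ 1)
    (hT : ‖T - (ContinuousLinearMap.id ℝ E - τ • S)‖ ≤ K₂ * τ ^ 2)
    (hr : ‖fAx - (fx - τ • L wx)‖ ≤ C₁ * τ ^ 2)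
    (hfAx : ‖fAx‖ ≤ F₀) (hL : ‖L‖ ≤ F₁) (hS : ‖S‖ ≤ W₁) (hwx : ‖wx‖ ≤ W₀) :
    ‖adjoint T fAx - (fx - τ • (L wx + adjoint S fx))‖ ≤
      (K₂ * F₀ + C₁ + W₁ * C₁ + W₁ * F₁ * W₀) * τ ^ 2 := by
  have hK₂τ : 0 ≤ K₂ * τ ^ 2 := (norm_nonneg _).trans hT
  have hC₁τ : 0 ≤ C₁ * τ ^ 2 := (norm_nonneg _).trans hr
  have hF₁ : 0 ≤ F₁ := (norm_nonneg _).trans hL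
  have hW₁ : 0 ≤ W₁ := (norm_nonneg _).trans hS
  have key : adjoint T fAx - (fx - τ • (L wx + adjoint S fx)) =
      (adjoint T fAx - (fAx - τ • adjoint S fAx)) + (fAx - (fx - τ • L wx))
        - τ • adjoint S (fAx - (fx - τ • L wx)) + τ ^ 2 • adjoint S (L wx) := by
    simp only [map_sub, map_smul, smul_add, smul_sub, smul_smul, pow_two]
    abel
  rw [key, tautLoopWeber_adjoint_expand]
  have hSadj : ‖adjoint S‖ ≤ W₁ := by rwa [ContinuousLinearMap.adjoint.norm_map]
  have ha : ‖adjoint (T - (ContinuousLinearMap.id ℝ E - τ • S)) fAx‖ ≤ K₂ * τ ^ 2 * F₀ := by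
    refine ((adjoint (T - (ContinuousLinearMap.id ℝ E - τ • S))).le_opNorm fAx).trans ?_
    rw [ContinuousLinearMap.adjoint.norm_map]
    exact mul_le_mul hT hfAx (norm_nonneg _) hK₂τ
  have hc : ‖τ • adjoint S (fAx - (fx - τ • L wx))‖ ≤ τ * (W₁ * (C₁ * τ ^ 2)) := by
    rw [norm_smul, Real.norm_eq_abs, abs_of_nonneg hτ₀]
    refine mul_le_mul_of_nonneg_left (((adjoint S).le_opNorm _).trans ?_) hτ₀
    exact mul_le_mul hSadj hr (norm_nonneg _) hW₁
  have hd : ‖τ ^ 2 • adjoint S (L wx)‖ ≤ τ ^ 2 * (W₁ * (F₁ * W₀)) := by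
    rw [norm_smul, Real.norm_eq_abs, abs_of_nonneg (sq_nonneg τ)]
    refine mul_le_mul_of_nonneg_left (((adjoint S).le_opNorm _).trans ?_) (sq_nonneg τ)
    refine mul_le_mul hSadj ((L.le_opNorm wx).trans ?_) (norm_nonneg _) hW₁
    exact mul_le_mul hL hwx (norm_nonneg _) hF₁
  have hτ3 : τ * (W₁ * (C₁ * τ ^ 2)) ≤ W₁ * C₁ * τ ^ 2 := by
    nlinarith [mul_nonneg (sub_nonneg.2 hτ₁) (mul_nonneg hW₁ hC₁τ)]
  calc _ ≤ K₂ * τ ^ 2 * F₀ + C₁ * τ ^ 2 + τ * (W₁ * (C₁ * τ ^ 2)) + τ ^ 2 * (W₁ * (F₁ * W₀)) :=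
        norm_add_le_of_le (norm_sub_le_of_le (norm_add_le_of_le ha hr) hc) hd
    _ ≤ (K₂ * F₀ + C₁ + W₁ * C₁ + W₁ * F₁ * W₀) * τ ^ 2 := by nlinarith [hτ3]

end Adjoint

/-! ## Assembly on `ℝ³` -/

section R3

local notation3 "E3" => EuclideanSpace ℝ (Fin 3)

/-- **Consistency of the pulled-back transport to second order** on `ℝ³`: if
`‖A − (id − τ w)‖_∞ ≤ K₁ τ²`, `‖DA − (id − τ Dw)‖_∞ ≤ K₂ τ²`, `0 ≤ τ ≤ 1`, `‖f‖ ≤ F₀`, `‖Df‖ ≤ F₁`,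
`‖D²f‖ ≤ F₂`, `‖w‖ ≤ W₀`, `‖Dw‖ ≤ W₁`, then
`‖(DA)† (f ∘ A) − (f − τ [(Df) w + (Dw)† f])‖_∞ ≤ K τ²` with
`K = K₂ F₀ + (1 + W₁)(F₂ (K₁ + W₀)² + F₁ K₁) + W₁ F₁ W₀`, a constant depending only on the
bounds. [folklore] -/
theorem tautLoopWeber_consistency (K₁ K₂ F₀ F₁ F₂ W₀ W₁ : ℝ) (hK₁ : 0 ≤ K₁) (hK₂ : 0 ≤ K₂)
    (hF₀ : 0 ≤ F₀) (hF₁ : 0 ≤ F₁) (hF₂ : 0 ≤ F₂) (hW₀ : 0 ≤ W₀) (hW₁ : 0 ≤ W₁) :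
    ∃ K : ℝ, 0 ≤ K ∧ ∀ (A w f : E3 → E3) (τ : ℝ), 0 ≤ τ → τ ≤ 1 → ContDiff ℝ 1 A →
      ContDiff ℝ 1 w → ContDiff ℝ 2 f → (∀ x, ‖A x - (x - τ • w x)‖ ≤ K₁ * τ ^ 2) →
      (∀ x, ‖fderiv ℝ A x - (ContinuousLinearMap.id ℝ E3 - τ • fderiv ℝ w x)‖ ≤ K₂ * τ ^ 2) →
      (∀ x, ‖f x‖ ≤ F₀) → (∀ x, ‖fderiv ℝ f x‖ ≤ F₁) → (∀ x, ‖iteratedFDeriv ℝ 2 f x‖ ≤ F₂) →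
      (∀ x, ‖w x‖ ≤ W₀) → (∀ x, ‖fderiv ℝ w x‖ ≤ W₁) →
      ∀ x, ‖adjoint (fderiv ℝ A x) (f (A x)) -
        (f x - τ • (fderiv ℝ f x (w x) + adjoint (fderiv ℝ w x) (f x)))‖ ≤ K * τ ^ 2 := by
  refine ⟨K₂ * F₀ + (F₂ * (K₁ + W₀) ^ 2 + F₁ * K₁) + W₁ * (F₂ * (K₁ + W₀) ^ 2 + F₁ * K₁) +
    W₁ * F₁ * W₀, by positivity, ?_⟩
  intro A w f τ hτ₀ hτ₁ _hA _hw hf hAx hDA hf₀ hf₁ hf₂ hw₀ hw₁ x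
  exact tautLoopWeber_pointwise hτ₀ hτ₁ (hDA x)
    (tautLoopWeber_transport_remainder hτ₀ hτ₁ hK₁ hf hf₁ hf₂ (hAx x) (hw₀ x))
    (hf₀ (A x)) (hf₁ x) (hw₁ x) (hw₀ x)

/-- **Tools stub `stub_tautLoopStepWeberTools`** (registered signature, verbatim): the
Weber / Cauchy–Kelvin pull-back identity `∮_{A ∘ γ} f = ∮_γ (DA)† (f ∘ A)`, the image of a closed
`C¹` loop under a `C¹` map is a closed `C¹` loop, and the second-order consistency of the
pulled-back transport `(DA)† (f ∘ A) = f − τ [(Df) w + (Dw)† f] + O(τ²)`. [folklore] -/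
theorem stub_tautLoopStepWeberTools :
    (∀ (A : EuclideanSpace ℝ (Fin 3) → EuclideanSpace ℝ (Fin 3)) (f : EuclideanSpace ℝ (Fin 3) →
    EuclideanSpace ℝ (Fin 3)) (γ : ℝ → EuclideanSpace ℝ (Fin 3)), ContDiff ℝ 1 A → Continuous f →
    Literature.Analysis.FluidPDE.IsC1Loop γ → Literature.Analysis.FluidPDE.circulation f (A ∘ γ) =
    Literature.Analysis.FluidPDE.circulation (fun x => ContinuousLinearMap.adjoint (fderiv ℝ A x)
    (f (A x))) γ) ∧ (∀ (A : EuclideanSpace ℝ (Fin 3) → EuclideanSpace ℝ (Fin 3)) (γ : ℝ →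
    EuclideanSpace ℝ (Fin 3)), ContDiff ℝ 1 A → Literature.Analysis.FluidPDE.IsC1Loop γ →
    Literature.Analysis.FluidPDE.IsC1Loop (A ∘ γ)) ∧ (∀ (K₁ K₂ F₀ F₁ F₂ W₀ W₁ : ℝ), 0 ≤ K₁ → 0 ≤
    K₂ → 0 ≤ F₀ → 0 ≤ F₁ → 0 ≤ F₂ → 0 ≤ W₀ → 0 ≤ W₁ → ∃ K : ℝ, 0 ≤ K ∧ ∀ (A w f : EuclideanSpace ℝ
    (Fin 3) → EuclideanSpace ℝ (Fin 3)) (τ : ℝ), 0 ≤ τ → τ ≤ 1 → ContDiff ℝ 1 A → ContDiff ℝ 1 w →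
    ContDiff ℝ 2 f → (∀ x, ‖A x - (x - τ • w x)‖ ≤ K₁ * τ ^ 2) → (∀ x, ‖fderiv ℝ A x -
    (ContinuousLinearMap.id ℝ (EuclideanSpace ℝ (Fin 3)) - τ • fderiv ℝ w x)‖ ≤ K₂ * τ ^ 2) → (∀
    x, ‖f x‖ ≤ F₀) → (∀ x, ‖fderiv ℝ f x‖ ≤ F₁) → (∀ x, ‖iteratedFDeriv ℝ 2 f x‖ ≤ F₂) → (∀ x, ‖w
    x‖ ≤ W₀) → (∀ x, ‖fderiv ℝ w x‖ ≤ W₁) → ∀ x, ‖ContinuousLinearMap.adjoint (fderiv ℝ A x) (f (A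
    x)) - (f x - τ • (fderiv ℝ f x (w x) + ContinuousLinearMap.adjoint (fderiv ℝ w x) (f x)))‖ ≤ K
    * τ ^ 2) :=
  ⟨fun _A f _γ hA _ hγ => tautLoopWeber_circulation_comp_of_isC1Loop f hA hγ,
    fun _A _γ hA hγ => tautLoopWeber_isC1Loop_comp hA hγ,
    tautLoopWeber_consistency⟩

end R3

end Summit.NavierStokesRegularity.NavierStokesRegularity.Theorems

end
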